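import Mathlib
import HarnessLib
import Summits.Parity.GeneralizedHardyLittlewood.Theorems.DilatedChowla.Negative.DilatedChowlaMirrorDefs

/-!
# `DilatedChowla` (stmt-Parity-13319): interfaces of the analytic stub of the mirror line

The analytic stub of the line `Sketch` (card `siegel-mirror`) for the crux `LiouvilleMAD.DilatedChowla`
is: Siegel zeros of quality `η ≥ C₀ log q` at arbitrarily large conductors ⇒ `CoherentBias 1`
(then `not_dilatedChowla_of_coherentBias` gives the mirror `DilatedChowla → ¬ SiegelZerosAbove (C₀·log)`).
This file fixes the VOCABULARY and the two intermediate LAWS through which that stub is proved, so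
that its pieces can be proved in separate files by separate hands:

* `T k y` — the Liouville sum over the unit class, `Σ_{1 ≤ u ≤ y, u ≡ 1 (mod k)} λ(u)`;
  `B Ξ y` — the twisted Liouville sum `Σ_{1 ≤ u ≤ y} λ(u) Ξ(u)` for a Dirichlet character `Ξ mod k`.
* `CharTwistLaw c₁ C₁ C₂` — the per-character law: if a real character `ψ ≠ 1 mod k` has a real zero
  `β ∈ (1 − c₁/log(4k), 1)` (an exceptional zero; by Page–Landau it is then unique and simple among
  all characters mod `k`), then for every character `Ξ mod k` and every `y ≥ exp(C₁(1 + log k)²)`,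
  `B Ξ y = [Ξ = ψ]·R·y^β/β + O((R+1)·y/k⁴)` with a main-term constant `R ≥ 1/(C₂(1+log k)⁵)`
  (`R = L(2β,𝟙_k)/L'(β,ψ) > 0`; Landau's method with two poles, MV Theorem 11.16, for the
  non-negative coefficients `1 + Re(Ξ(u))λ(u)`).
* `OnePointExcLaw c₁ C₁ C₂` — the unit-class law: same hypotheses ⇒
  `T k y = R·y^β/(φ(k)β) + O((R+1)·y/k³)` (from `CharTwistLaw` by orthogonality).
* `Mtw Ξ x` — the twisted Möbius sum; `MoebiusExcLaw`, `MoebiusNonexcLaw`, `MoebiusLaws` — the same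
  laws one layer down, for `μ` (where the tree's Landau engine `ExcPsiData` applies directly:
  `MoebiusTwist.exists_excPsiData_twist/_all`), from which the `λ`-laws follow by `λ = 𝟙_□ ∗ μ`
  (`LiouvilleCharSumLinnikBox.sum_liouville_twist_eq`).
* `CharTwist`, `OnePointExc` — the laws with the constants existentially quantified.

Road map (separate files): `MoebiusExcLaw` (explicit exceptional branch of the Landau engine, file
`DilatedChowlaMirrorMoebiusExc`); `MoebiusNonexcLaw` (file `DilatedChowlaMirrorMoebiusNonexc`);
`MoebiusLaws → CharTwist` (transfer, file `DilatedChowlaMirrorTransfer`); `CharTwistLaw → OnePointExcLaw`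
(orthogonality, file `DilatedChowlaMirrorOrthogonality`); `OnePointExc → ∃ C₀ > 0,
SiegelZerosAbove (C₀·log) → CoherentBias 1` (parameter bookkeeping, file `DilatedChowlaMirrorBias`).
Nothing here is a cited theorem; the laws are this line's own intermediate statements (classical in
content: the prime-number-theorem-type asymptotics for `μ` and `λ` in the presence of an exceptional
zero, Montgomery–Vaughan §11.3).
-/

noncomputable section

namespace Summit.Parity.GeneralizedHardyLittlewood.Theorems.DilatedChowla.Negative

open Finset
open scoped Classical

/-! ## §1 One-point sums -/

/-- The Liouville sum over the unit class: `T k y = Σ_{1 ≤ u ≤ ⌊y⌋, u ≡ 1 (mod k)} λ(u)`. -/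
def T (k : ℕ) (y : ℝ) : ℝ :=
  ∑ u ∈ (Icc 1 ⌊y⌋₊).filter (fun u : ℕ => u ≡ 1 [MOD k]), (ArithmeticFunction.liouville u : ℝ)

/-- The twisted Liouville sum `B Ξ y = Σ_{1 ≤ u ≤ ⌊y⌋} λ(u) Ξ(u)` of a Dirichlet character `Ξ mod k`. -/
def B {k : ℕ} (Ξ : DirichletCharacter ℂ k) (y : ℝ) : ℂ :=
  ∑ u ∈ Icc 1 ⌊y⌋₊, (ArithmeticFunction.liouville u : ℂ) * Ξ (u : ZMod k)

/-! ## §2 The per-character law and the unit-class law -/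

/-- **Per-character exceptional-zero law with constants `c₁, C₁, C₂`.**  For every modulus `k`, every
real character `ψ ≠ 1 mod k` and every real zero `β ∈ (1 − c₁/log(4k), 1)` of `L(s,ψ)` there is a
main-term constant `R ≥ 1/(C₂ (1 + log k)⁵)` such that for every Dirichlet character `Ξ mod k` and
every `y ≥ exp(C₁ (1 + log k)²)`:
`‖B Ξ y − [Ξ = ψ] · R · y^β/β‖ ≤ (R + 1) · y / k⁴`. -/
def CharTwistLaw (c₁ C₁ C₂ : ℝ) : Prop :=
  ∀ (k : ℕ) [NeZero k] (ψ : DirichletCharacter ℂ k), ψ ≠ 1 → ψ ^ 2 = 1 →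
    ∀ β : ℝ, 1 - c₁ / Real.log (4 * k) < β → β < 1 → ψ.LFunction (β : ℂ) = 0 →
      ∃ R : ℝ, 1 / (C₂ * (1 + Real.log k) ^ 5) ≤ R ∧
        ∀ (Ξ : DirichletCharacter ℂ k) (y : ℝ), Real.exp (C₁ * (1 + Real.log k) ^ 2) ≤ y →
          ‖B Ξ y - (if Ξ = ψ then ((R * y ^ β / β : ℝ) : ℂ) else 0)‖ ≤ (R + 1) * y / (k : ℝ) ^ 4

/-- **Unit-class exceptional-zero law with constants `c₁, C₁, C₂`.**  Same hypotheses; conclusion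
for the unit class: `|T k y − R · y^β/(φ(k) β)| ≤ (R + 1) · y / k³` for `y ≥ exp(C₁ (1 + log k)²)`. -/
def OnePointExcLaw (c₁ C₁ C₂ : ℝ) : Prop :=
  ∀ (k : ℕ) [NeZero k] (ψ : DirichletCharacter ℂ k), ψ ≠ 1 → ψ ^ 2 = 1 →
    ∀ β : ℝ, 1 - c₁ / Real.log (4 * k) < β → β < 1 → ψ.LFunction (β : ℂ) = 0 →
      ∃ R : ℝ, 1 / (C₂ * (1 + Real.log k) ^ 5) ≤ R ∧
        ∀ y : ℝ, Real.exp (C₁ * (1 + Real.log k) ^ 2) ≤ y →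
          |T k y - R * y ^ β / ((Nat.totient k : ℝ) * β)| ≤ (R + 1) * y / (k : ℝ) ^ 3

/-! ## §3 The Möbius layer (the laws are proved for `μ` first and transferred to `λ = 𝟙_□ ∗ μ`) -/

/-- The twisted Möbius sum `Mtw Ξ x = Σ_{1 ≤ n ≤ ⌊x⌋} μ(n) Ξ(n)` of a Dirichlet character `Ξ mod k`
(the `M(x, χ)` of Montgomery–Vaughan (11.39), tree `MoebiusCharacterSumBound`). -/
def Mtw {k : ℕ} (Ξ : DirichletCharacter ℂ k) (x : ℝ) : ℂ :=
  ∑ n ∈ Icc 1 ⌊x⌋₊, (ArithmeticFunction.moebius n : ℂ) * Ξ (n : ZMod k)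

/-- **Möbius exceptional-character law with constants `c₁, C₁, C₂`.**  For a real character
`ψ ≠ 1 mod k` with a real zero `β ∈ (1 − c₁/log(4k), 1)` of `L(s,ψ)`: `L'(β,ψ)` is real with
`0 < L'(β,ψ) ≤ C₂ (1 + log k)²`, and for `x ≥ exp(C₁ (1 + log k)²)`
`‖Mtw ψ x − x^β/(β L'(β,ψ))‖ ≤ x/k⁶`
(Landau's method with the two poles `s = 1`, `s = β` for `1 + μ(n)ψ(n)/(K log 4k + 1)`:
Montgomery–Vaughan §11.3 Exercises 7–8 with Theorem 11.16, tree `MoebiusTwist.exists_excPsiData_twist`,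
whose exceptional branch has residue `1/L'(β,ψ)`). -/
def MoebiusExcLaw (c₁ C₁ C₂ : ℝ) : Prop :=
  ∀ (k : ℕ) [NeZero k] (ψ : DirichletCharacter ℂ k), ψ ≠ 1 → ψ ^ 2 = 1 →
    ∀ β : ℝ, 1 - c₁ / Real.log (4 * k) < β → β < 1 → ψ.LFunction (β : ℂ) = 0 →
      0 < (deriv ψ.LFunction (β : ℂ)).re ∧
      (deriv ψ.LFunction (β : ℂ)).re ≤ C₂ * (1 + Real.log k) ^ 2 ∧
      ∀ x : ℝ, Real.exp (C₁ * (1 + Real.log k) ^ 2) ≤ x →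
        ‖Mtw ψ x - ((x ^ β / (β * (deriv ψ.LFunction (β : ℂ)).re) : ℝ) : ℂ)‖ ≤ x / (k : ℝ) ^ 6

/-- **Möbius non-exceptional-character law with constants `c₁, C₁`.**  If a real character
`ψ ≠ 1 mod k` owns a real zero `β ∈ (1 − c₁/log(4k), 1)`, then every OTHER character `Ξ mod k`
(principal, complex, or real `≠ ψ`; by Page–Landau none of them has a zero that close to `1`)
satisfies `‖Mtw Ξ x‖ ≤ x/k⁶` for `x ≥ exp(C₁ (1 + log k)²)` (tree `MoebiusTwist.exists_excPsiData_all`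
with `ExcPsiData.exists_psi_bound`; a possible residue term `α x^{β'}/β'` of a real `Ξ ≠ ψ` has
`β' ≤ 1 − c/log(4k)` by Landau's same-level repulsion and is absorbed). -/
def MoebiusNonexcLaw (c₁ C₁ : ℝ) : Prop :=
  ∀ (k : ℕ) [NeZero k] (ψ : DirichletCharacter ℂ k), ψ ≠ 1 → ψ ^ 2 = 1 →
    ∀ β : ℝ, 1 - c₁ / Real.log (4 * k) < β → β < 1 → ψ.LFunction (β : ℂ) = 0 →
      ∀ Ξ : DirichletCharacter ℂ k, Ξ ≠ ψ →
        ∀ x : ℝ, Real.exp (C₁ * (1 + Real.log k) ^ 2) ≤ x → ‖Mtw Ξ x‖ ≤ x / (k : ℝ) ^ 6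

/-- The Möbius laws with some positive constants (both at once: the transfer to `λ` consumes them
at common `c₁`, which `min` provides). -/
def MoebiusLaws : Prop :=
  ∃ c₁ C₁ C₂ : ℝ, 0 < c₁ ∧ 0 < C₁ ∧ 0 < C₂ ∧ MoebiusExcLaw c₁ C₁ C₂ ∧ MoebiusNonexcLaw c₁ C₁

/-- Shrinking `c₁` and enlarging `C₁` preserves the exceptional Möbius law. -/
theorem MoebiusExcLaw.mono {c₁ C₁ C₂ c₁' C₁' : ℝ} (hc : c₁' ≤ c₁) (hC : C₁ ≤ C₁')
    (h : MoebiusExcLaw c₁ C₁ C₂) : MoebiusExcLaw c₁' C₁' C₂ := by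
  intro k _ ψ hψ hψ2 β hβ hβ1 hL
  have hlog : 0 < Real.log (4 * k) := by
    have hk : (1 : ℝ) ≤ k := by exact_mod_cast NeZero.one_le
    exact Real.log_pos (by linarith)
  have hβ' : 1 - c₁ / Real.log (4 * k) < β :=
    lt_of_le_of_lt (by gcongr) hβ
  obtain ⟨h1, h2, h3⟩ := h k ψ hψ hψ2 β hβ' hβ1 hL
  refine ⟨h1, h2, fun x hx => h3 x (le_trans ?_ hx)⟩
  gcongr

/-- Shrinking `c₁` and enlarging `C₁` preserves the non-exceptional Möbius law. -/
theorem MoebiusNonexcLaw.mono {c₁ C₁ c₁' C₁' : ℝ} (hc : c₁' ≤ c₁) (hC : C₁ ≤ C₁')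
    (h : MoebiusNonexcLaw c₁ C₁) : MoebiusNonexcLaw c₁' C₁' := by
  intro k _ ψ hψ hψ2 β hβ hβ1 hL Ξ hΞ x hx
  have hlog : 0 < Real.log (4 * k) := by
    have hk : (1 : ℝ) ≤ k := by exact_mod_cast NeZero.one_le
    exact Real.log_pos (by linarith)
  have hβ' : 1 - c₁ / Real.log (4 * k) < β :=
    lt_of_le_of_lt (by gcongr) hβ
  exact h k ψ hψ hψ2 β hβ' hβ1 hL Ξ hΞ x (le_trans (by gcongr) hx)

/-! ## §4 Packaged forms -/

/-- The per-character law with some positive constants. -/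
def CharTwist : Prop :=
  ∃ c₁ C₁ C₂ : ℝ, 0 < c₁ ∧ 0 < C₁ ∧ 0 < C₂ ∧ CharTwistLaw c₁ C₁ C₂

/-- The unit-class law with some positive constants. -/
def OnePointExc : Prop :=
  ∃ c₁ C₁ C₂ : ℝ, 0 < c₁ ∧ 0 < C₁ ∧ 0 < C₂ ∧ OnePointExcLaw c₁ C₁ C₂

/-- Monotonicity of the laws in the constants is not needed; what is used downstream is only the
packaging `CharTwistLaw c₁ C₁ C₂ → OnePointExcLaw c₁ C₁ C₂ → …` at fixed constants, recorded here as
the trivial repackaging of an implication valid at all constants. -/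
theorem onePointExc_of_charTwist
    (h : ∀ c₁ C₁ C₂ : ℝ, 0 < c₁ → 0 < C₁ → 0 < C₂ → CharTwistLaw c₁ C₁ C₂ → OnePointExcLaw c₁ C₁ C₂)
    (hC : CharTwist) : OnePointExc := by
  obtain ⟨c₁, C₁, C₂, h₁, h₂, h₃, hlaw⟩ := hC
  exact ⟨c₁, C₁, C₂, h₁, h₂, h₃, h c₁ C₁ C₂ h₁ h₂ h₃ hlaw⟩

end Summit.Parity.GeneralizedHardyLittlewood.Theorems.DilatedChowla.Negative

end
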